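import Literature.Probability.LatticeModels.MessagerMiracleSole
import Literature.Probability.LatticeModels.CriticalTwoPointLower
import Literature.Probability.LatticeModels.IsingThermodynamics
import HarnessLib

/-!
# Line `free-box-deficit` (crux `ExistsContinuousLimit`, stmt-CriticalPhenomena-4582): stub `stub_mmsFaces`

Lead c5 (`prover-line-stmt-CriticalPhenomena-4582-c5-0`), registered skeleton
`Cruxes/ExistsContinuousLimit/Lines/free_box_deficit.lean`. The fold chain bounds `g(n) − freeA(n)` and
`Gd(n) − freeD(n)` by the sum, over the six faces of the free box, of the bulk critical two-point function at the
mirror image of the far point of the pair. This file proves the Messager–Miracle-Solé step: every image of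
`ne₀` in a face of the axis box `(−h, n+h) × (−h, h)²` is `≤ Gd(n) = G(n,n,0)`, and every image of `(n,n,0)` in a
face of the anisotropic coordinate box `(−h, n+h)² × (−n, n)` is `≤ g(2n)`, `h = ⌈n/2⌉` — by coordinate MMS
(`messager_miracleSole_holds`), diagonal MMS (`messager_miracleSole_diag_holds`) and the lattice symmetries
(`twoPointPlus_reflection_invariant_holds`, `twoPointPlus_perm_invariant_holds`).

References: A. Messager, S. Miracle-Solé, J. Stat. Phys. 17 (1977) 245; G. C. Hegerfeldt, CMP 57 (1977) 259;
S. Friedli, Y. Velenik, CUP 2017, §3.10.6 and Exercise 3.14.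
-/

noncomputable section

namespace Summit.CriticalPhenomena.Ising3DConformalLimit.ReflectionTwinExistsContinuousLimit.FreeBox

open Finset Filter
open scoped BigOperators symmDiff ENNReal Topology
open Literature.Probability.LatticeModels
open Classical

/-! ## MMS and symmetry steps for the critical two-point function in `![a,b,c]` coordinates -/

/-- `β_c(3) ≥ 0`. [folklore] -/
theorem hβc : 0 ≤ criticalBeta 3 := criticalBeta_nonneg 3

/-- Coordinate MMS in direction `0`: `G(a+1,b,c) ≤ G(a,b,c)` for `a ≥ 0`. [cite: MessagerMiracleSoleJSP1977, main theorem] -/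
theorem mms_zero {a : ℤ} (ha : 0 ≤ a) (b c : ℤ) : criticalTwoPoint 3 ![a + 1, b, c] ≤ criticalTwoPoint 3 ![a, b, c] := by
  have h := messager_miracleSole_holds (d := 3) (β := criticalBeta 3) hβc ![a, b, c] 0 (by simpa using ha)
  have heq : (![a, b, c] : Site 3) + Pi.single 0 1 = ![a + 1, b, c] := by
    funext j; fin_cases j <;> simp
  rw [heq] at h
  exact h

/-- Coordinate MMS in direction `1`: `G(a,b+1,c) ≤ G(a,b,c)` for `b ≥ 0`. [cite: MessagerMiracleSoleJSP1977, main theorem] -/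
theorem mms_one (a : ℤ) {b : ℤ} (hb : 0 ≤ b) (c : ℤ) : criticalTwoPoint 3 ![a, b + 1, c] ≤ criticalTwoPoint 3 ![a, b, c] := by
  have h := messager_miracleSole_holds (d := 3) (β := criticalBeta 3) hβc ![a, b, c] 1 (by simpa using hb)
  have heq : (![a, b, c] : Site 3) + Pi.single 1 1 = ![a, b + 1, c] := by
    funext j; fin_cases j <;> simp
  rw [heq] at h
  exact h

/-- Iterated coordinate MMS in direction `0`: `G(a+k,b,c) ≤ G(a,b,c)` for `a ≥ 0`, `k : ℕ`. [cite: MessagerMiracleSoleJSP1977, main theorem] -/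
theorem mms_zero_iter {a : ℤ} (ha : 0 ≤ a) (b c : ℤ) (k : ℕ) : criticalTwoPoint 3 ![a + k, b, c] ≤ criticalTwoPoint 3 ![a, b, c] := by
  induction k with
  | zero => simp
  | succ k ih =>
    have h := mms_zero (a := a + k) (by positivity) b c
    have : (a + k : ℤ) + 1 = a + ((k + 1 : ℕ) : ℤ) := by push_cast; ring
    rw [this] at h
    exact h.trans ih

/-- Iterated coordinate MMS in direction `1`: `G(a,b+k,c) ≤ G(a,b,c)` for `b ≥ 0`, `k : ℕ`. [cite: MessagerMiracleSoleJSP1977, main theorem] -/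
theorem mms_one_iter (a : ℤ) {b : ℤ} (hb : 0 ≤ b) (c : ℤ) (k : ℕ) : criticalTwoPoint 3 ![a, b + k, c] ≤ criticalTwoPoint 3 ![a, b, c] := by
  induction k with
  | zero => simp
  | succ k ih =>
    have h := mms_one a (b := b + k) (by positivity) c
    have : (b + k : ℤ) + 1 = b + ((k + 1 : ℕ) : ℤ) := by push_cast; ring
    rw [this] at h
    exact h.trans ih

/-- Diagonal MMS: `G(a+1, b−1, c) ≤ G(a,b,c)` for `b ≤ a`. [cite: MessagerMiracleSoleJSP1977, main theorem] -/
theorem mms_diag {a b : ℤ} (hab : b ≤ a) (c : ℤ) : criticalTwoPoint 3 ![a + 1, b - 1, c] ≤ criticalTwoPoint 3 ![a, b, c] := by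
  have h := messager_miracleSole_diag_holds (d := 3) (β := criticalBeta 3) hβc ![a, b, c] (i := 0) (j := 1)
    (by decide) (by simpa using hab)
  have heq : (![a, b, c] : Site 3) + Pi.single 0 1 - Pi.single 1 1 = ![a + 1, b - 1, c] := by
    funext j
    simp only [Pi.add_apply, Pi.sub_apply, Pi.single_apply]
    fin_cases j <;> simp
  rw [heq] at h
  exact h

/-- Iterated diagonal MMS: `G(a+k, b−k, c) ≤ G(a,b,c)` for `b ≤ a`, `k : ℕ`. [cite: MessagerMiracleSoleJSP1977, main theorem] -/
theorem mms_diag_iter {a b : ℤ} (hab : b ≤ a) (c : ℤ) (k : ℕ) : criticalTwoPoint 3 ![a + k, b - k, c] ≤ criticalTwoPoint 3 ![a, b, c] := by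
  induction k with
  | zero => simp
  | succ k ih =>
    have h := mms_diag (a := a + k) (b := b - k) (by omega) c
    have h1 : (a + k : ℤ) + 1 = a + ((k + 1 : ℕ) : ℤ) := by push_cast; ring
    have h2 : (b - k : ℤ) - 1 = b - ((k + 1 : ℕ) : ℤ) := by push_cast; ring
    rw [h1, h2] at h
    exact h.trans ih

/-- Reflection symmetry in coordinate `0`. [cite: FriedliVelenik2017, Exercise 3.14] -/
theorem refl_zero (a b c : ℤ) : criticalTwoPoint 3 ![-a, b, c] = criticalTwoPoint 3 ![a, b, c] := by
  have h := twoPointPlus_reflection_invariant_holds (d := 3) hβc 0 ![a, b, c]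
  have heq : Function.update (![a, b, c] : Site 3) 0 (-(![a, b, c] : Site 3) 0) = ![-a, b, c] := by
    funext j; fin_cases j <;> simp
  rw [heq] at h
  exact h

/-- Reflection symmetry in coordinate `1`. [cite: FriedliVelenik2017, Exercise 3.14] -/
theorem refl_one (a b c : ℤ) : criticalTwoPoint 3 ![a, -b, c] = criticalTwoPoint 3 ![a, b, c] := by
  have h := twoPointPlus_reflection_invariant_holds (d := 3) hβc 1 ![a, b, c]
  have heq : Function.update (![a, b, c] : Site 3) 1 (-(![a, b, c] : Site 3) 1) = ![a, -b, c] := by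
    funext j; fin_cases j <;> simp
  rw [heq] at h
  exact h

/-- Reflection symmetry in coordinate `2`. [cite: FriedliVelenik2017, Exercise 3.14] -/
theorem refl_two (a b c : ℤ) : criticalTwoPoint 3 ![a, b, -c] = criticalTwoPoint 3 ![a, b, c] := by
  have h := twoPointPlus_reflection_invariant_holds (d := 3) hβc 2 ![a, b, c]
  have heq : Function.update (![a, b, c] : Site 3) 2 (-(![a, b, c] : Site 3) 2) = ![a, b, -c] := by
    funext j; fin_cases j <;> simp
  rw [heq] at h
  exact h

/-- Permutation symmetry: swap coordinates `0` and `1`. [cite: FriedliVelenik2017, Exercise 3.14] -/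
theorem perm_01 (a b c : ℤ) : criticalTwoPoint 3 ![b, a, c] = criticalTwoPoint 3 ![a, b, c] := by
  have h := twoPointPlus_perm_invariant_holds (d := 3) hβc (Equiv.swap 0 1) ![a, b, c]
  have heq : (fun i => (![a, b, c] : Site 3) (Equiv.swap 0 1 i)) = ![b, a, c] := by
    funext j; fin_cases j <;> simp [Equiv.swap_apply_of_ne_of_ne]
  rw [heq] at h
  exact h

/-- Permutation symmetry: swap coordinates `1` and `2`. [cite: FriedliVelenik2017, Exercise 3.14] -/
theorem perm_12 (a b c : ℤ) : criticalTwoPoint 3 ![a, c, b] = criticalTwoPoint 3 ![a, b, c] := by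
  have h := twoPointPlus_perm_invariant_holds (d := 3) hβc (Equiv.swap 1 2) ![a, b, c]
  have heq : (fun i => (![a, b, c] : Site 3) (Equiv.swap 1 2 i)) = ![a, c, b] := by
    funext j; fin_cases j <;> simp [Equiv.swap_apply_of_ne_of_ne]
  rw [heq] at h
  exact h

/-- Permutation symmetry: swap coordinates `0` and `2`. [cite: FriedliVelenik2017, Exercise 3.14] -/
theorem perm_02 (a b c : ℤ) : criticalTwoPoint 3 ![c, b, a] = criticalTwoPoint 3 ![a, b, c] := by
  have h := twoPointPlus_perm_invariant_holds (d := 3) hβc (Equiv.swap 0 2) ![a, b, c]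
  have heq : (fun i => (![a, b, c] : Site 3) (Equiv.swap 0 2 i)) = ![c, b, a] := by
    funext j; fin_cases j <;> simp [Equiv.swap_apply_of_ne_of_ne]
  rw [heq] at h
  exact h

/-! ## The six images of `ne₀` (axis box) and of `(n,n,0)` (diagonal box) -/

/-- `G(n+2h, 0, 0) ≤ G(n,n,0)` when `2h ≥ n`: axis MMS down to `2n`, then diagonal MMS. [cite: MessagerMiracleSoleJSP1977, main theorem] -/
theorem axis_far_le {n h : ℕ} (hh : n ≤ 2 * h) : criticalTwoPoint 3 ![(n : ℤ) + 2 * h, 0, 0] ≤ criticalTwoPoint 3 ![(n : ℤ), n, 0] := by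
  have h1 : criticalTwoPoint 3 ![(n : ℤ) + 2 * h, 0, 0] ≤ criticalTwoPoint 3 ![2 * (n : ℤ), 0, 0] := by
    have := mms_zero_iter (a := 2 * (n : ℤ)) (by positivity) 0 0 (2 * h - n)
    have e : (2 * (n : ℤ)) + ((2 * h - n : ℕ) : ℤ) = (n : ℤ) + 2 * h := by omega
    rwa [e] at this
  have h2 : criticalTwoPoint 3 ![2 * (n : ℤ), 0, 0] ≤ criticalTwoPoint 3 ![(n : ℤ), n, 0] := by
    have := mms_diag_iter (a := (n : ℤ)) (b := (n : ℤ)) le_rfl 0 n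
    have e1 : (n : ℤ) + n = 2 * n := by ring
    have e2 : (n : ℤ) - n = 0 := by ring
    rwa [e1, e2] at this
  exact h1.trans h2

/-- `G(n, 2h, 0) ≤ G(n,n,0)` when `2h ≥ n`. [cite: MessagerMiracleSoleJSP1977, main theorem] -/
theorem axis_side_le {n h : ℕ} (hh : n ≤ 2 * h) : criticalTwoPoint 3 ![(n : ℤ), 2 * h, 0] ≤ criticalTwoPoint 3 ![(n : ℤ), n, 0] := by
  have := mms_one_iter (n : ℤ) (b := (n : ℤ)) (by positivity) 0 (2 * h - n)
  have e : (n : ℤ) + ((2 * h - n : ℕ) : ℤ) = 2 * h := by omega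
  rwa [e] at this

/-- `G(n+2h, n, 0) ≤ G(2n, 0, 0)` when `2h ≥ n`. [cite: MessagerMiracleSoleJSP1977, main theorem] -/
theorem diag_far_le {n h : ℕ} (hh : n ≤ 2 * h) : criticalTwoPoint 3 ![(n : ℤ) + 2 * h, n, 0] ≤ criticalTwoPoint 3 ![2 * (n : ℤ), 0, 0] := by
  have h1 : criticalTwoPoint 3 ![(n : ℤ) + 2 * h, n, 0] ≤ criticalTwoPoint 3 ![(n : ℤ) + 2 * h, 0, 0] := by
    have := mms_one_iter ((n : ℤ) + 2 * h) (b := 0) le_rfl 0 n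
    rwa [zero_add] at this
  have h2 : criticalTwoPoint 3 ![(n : ℤ) + 2 * h, 0, 0] ≤ criticalTwoPoint 3 ![2 * (n : ℤ), 0, 0] := by
    have := mms_zero_iter (a := 2 * (n : ℤ)) (by positivity) 0 0 (2 * h - n)
    have e : (2 * (n : ℤ)) + ((2 * h - n : ℕ) : ℤ) = (n : ℤ) + 2 * h := by omega
    rwa [e] at this
  exact h1.trans h2

/-- `G(n, n, 2n) ≤ G(2n, 0, 0)`. [cite: MessagerMiracleSoleJSP1977, main theorem] -/
theorem diag_top_le (n : ℕ) : criticalTwoPoint 3 ![(n : ℤ), n, 2 * n] ≤ criticalTwoPoint 3 ![2 * (n : ℤ), 0, 0] := by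
  have h1 : criticalTwoPoint 3 ![(n : ℤ), n, 2 * n] ≤ criticalTwoPoint 3 ![0, n, 2 * n] := by
    have := mms_zero_iter (a := 0) le_rfl (n : ℤ) (2 * n) n
    rwa [zero_add] at this
  have h2 : criticalTwoPoint 3 ![(0 : ℤ), n, 2 * n] ≤ criticalTwoPoint 3 ![0, 0, 2 * (n : ℤ)] := by
    have := mms_one_iter 0 (b := 0) le_rfl (2 * (n : ℤ)) n
    rwa [zero_add] at this
  have h3 : criticalTwoPoint 3 ![(0 : ℤ), 0, 2 * n] = criticalTwoPoint 3 ![2 * (n : ℤ), 0, 0] := perm_02 _ _ _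
  exact (h1.trans h2).trans h3.le

/-- **Registered stub `stub_mmsFaces`** of the line `free-box-deficit` (crux stmt-CriticalPhenomena-4582): the twelve
Messager–Miracle-Solé bounds, summed. -/
theorem stub_mmsFaces : ∀ n : ℕ, 1 ≤ n →
    (∑ i : Fin 3, (criticalTwoPoint 3 (Function.update (Pi.single 0 (n : ℤ) : Site 3) i
          (2 * ((fun i : Fin 3 => if i = 0 then (n : ℤ) + (((n + 1) / 2 : ℕ) : ℤ) - 1 else (((n + 1) / 2 : ℕ) : ℤ) - 1) i + 1) -
            (Pi.single 0 (n : ℤ) : Site 3) i)) +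
        criticalTwoPoint 3 (Function.update (Pi.single 0 (n : ℤ) : Site 3) i
          (2 * ((fun _ : Fin 3 => 1 - (((n + 1) / 2 : ℕ) : ℤ)) i - 1) - (Pi.single 0 (n : ℤ) : Site 3) i))) ≤
      6 * criticalTwoPoint 3 (Pi.single 0 (n : ℤ) + Pi.single 1 (n : ℤ))) ∧
    (∑ i : Fin 3, (criticalTwoPoint 3 (Function.update (Pi.single 0 (n : ℤ) + Pi.single 1 (n : ℤ) : Site 3) i
          (2 * ((fun i : Fin 3 => if i = 2 then (n : ℤ) - 1 else (n : ℤ) + (((n + 1) / 2 : ℕ) : ℤ) - 1) i + 1) -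
            (Pi.single 0 (n : ℤ) + Pi.single 1 (n : ℤ) : Site 3) i)) +
        criticalTwoPoint 3 (Function.update (Pi.single 0 (n : ℤ) + Pi.single 1 (n : ℤ) : Site 3) i
          (2 * ((fun i : Fin 3 => if i = 2 then 1 - (n : ℤ) else 1 - (((n + 1) / 2 : ℕ) : ℤ)) i - 1) -
            (Pi.single 0 (n : ℤ) + Pi.single 1 (n : ℤ) : Site 3) i))) ≤
      6 * criticalTwoPoint 3 (Pi.single 0 (2 * (n : ℤ)))) := by
  intro n hn
  set h : ℕ := (n + 1) / 2 with hh_def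
  have hh : n ≤ 2 * h := by omega
  -- canonical forms of the two reference values
  have eGd : criticalTwoPoint 3 (Pi.single 0 (n : ℤ) + Pi.single 1 (n : ℤ)) = criticalTwoPoint 3 ![(n : ℤ), n, 0] :=
    congrArg (criticalTwoPoint 3) (by funext j; fin_cases j <;> simp)
  have eg2 : criticalTwoPoint 3 (Pi.single 0 (2 * (n : ℤ))) = criticalTwoPoint 3 ![2 * (n : ℤ), 0, 0] :=
    congrArg (criticalTwoPoint 3) (by funext j; fin_cases j <;> simp)
  have Gd_def : criticalTwoPoint 3 ![(n : ℤ) + 2 * h, 0, 0] ≤ criticalTwoPoint 3 ![(n : ℤ), n, 0] := axis_far_le hh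
  have Gs_def : criticalTwoPoint 3 ![(n : ℤ), 2 * h, 0] ≤ criticalTwoPoint 3 ![(n : ℤ), n, 0] := axis_side_le hh
  have Df_def : criticalTwoPoint 3 ![(n : ℤ) + 2 * h, n, 0] ≤ criticalTwoPoint 3 ![2 * (n : ℤ), 0, 0] := diag_far_le hh
  have Dt_def : criticalTwoPoint 3 ![(n : ℤ), n, 2 * n] ≤ criticalTwoPoint 3 ![2 * (n : ℤ), 0, 0] := diag_top_le n
  constructor
  · -- the axis box: images of `ne₀`
    set y : Site 3 := Pi.single 0 (n : ℤ) with hy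
    have t1 : criticalTwoPoint 3 (Function.update y 0 (2 * (((n : ℤ) + h - 1) + 1) - y 0)) ≤ criticalTwoPoint 3 ![(n : ℤ), n, 0] := by
      have e : Function.update y 0 (2 * (((n : ℤ) + h - 1) + 1) - y 0) = ![2 * (((n : ℤ) + h - 1) + 1) - (n : ℤ), 0, 0] := by
        funext j; fin_cases j <;> simp [hy]
      rw [e, show 2 * (((n : ℤ) + h - 1) + 1) - (n : ℤ) = (n : ℤ) + 2 * h by ring]; exact Gd_def
    have t2 : criticalTwoPoint 3 (Function.update y 0 (2 * ((1 - (h : ℤ)) - 1) - y 0)) ≤ criticalTwoPoint 3 ![(n : ℤ), n, 0] := by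
      have e : Function.update y 0 (2 * ((1 - (h : ℤ)) - 1) - y 0) = ![2 * ((1 - (h : ℤ)) - 1) - (n : ℤ), 0, 0] := by
        funext j; fin_cases j <;> simp [hy]
      rw [e, show 2 * ((1 - (h : ℤ)) - 1) - (n : ℤ) = -((n : ℤ) + 2 * h) by ring, refl_zero]; exact Gd_def
    have t3 : criticalTwoPoint 3 (Function.update y 1 (2 * (((h : ℤ) - 1) + 1) - y 1)) ≤ criticalTwoPoint 3 ![(n : ℤ), n, 0] := by
      have e : Function.update y 1 (2 * (((h : ℤ) - 1) + 1) - y 1) = ![(n : ℤ), 2 * (((h : ℤ) - 1) + 1) - 0, 0] := by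
        funext j; fin_cases j <;> simp [hy]
      rw [e, show 2 * (((h : ℤ) - 1) + 1) - 0 = 2 * (h : ℤ) by ring]; exact Gs_def
    have t4 : criticalTwoPoint 3 (Function.update y 1 (2 * ((1 - (h : ℤ)) - 1) - y 1)) ≤ criticalTwoPoint 3 ![(n : ℤ), n, 0] := by
      have e : Function.update y 1 (2 * ((1 - (h : ℤ)) - 1) - y 1) = ![(n : ℤ), 2 * ((1 - (h : ℤ)) - 1) - 0, 0] := by
        funext j; fin_cases j <;> simp [hy]
      rw [e, show 2 * ((1 - (h : ℤ)) - 1) - 0 = -(2 * (h : ℤ)) by ring, refl_one]; exact Gs_def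
    have t5 : criticalTwoPoint 3 (Function.update y 2 (2 * (((h : ℤ) - 1) + 1) - y 2)) ≤ criticalTwoPoint 3 ![(n : ℤ), n, 0] := by
      have e : Function.update y 2 (2 * (((h : ℤ) - 1) + 1) - y 2) = ![(n : ℤ), 0, 2 * (((h : ℤ) - 1) + 1) - 0] := by
        funext j; fin_cases j <;> simp [hy]
      rw [e, show 2 * (((h : ℤ) - 1) + 1) - 0 = 2 * (h : ℤ) by ring, perm_12]; exact Gs_def
    have t6 : criticalTwoPoint 3 (Function.update y 2 (2 * ((1 - (h : ℤ)) - 1) - y 2)) ≤ criticalTwoPoint 3 ![(n : ℤ), n, 0] := by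
      have e : Function.update y 2 (2 * ((1 - (h : ℤ)) - 1) - y 2) = ![(n : ℤ), 0, 2 * ((1 - (h : ℤ)) - 1) - 0] := by
        funext j; fin_cases j <;> simp [hy]
      rw [e, show 2 * ((1 - (h : ℤ)) - 1) - 0 = -(2 * (h : ℤ)) by ring, refl_two, perm_12]; exact Gs_def
    have expand : (∑ i : Fin 3, (criticalTwoPoint 3 (Function.update y i
          (2 * ((fun i : Fin 3 => if i = 0 then (n : ℤ) + (h : ℤ) - 1 else (h : ℤ) - 1) i + 1) - y i)) +
        criticalTwoPoint 3 (Function.update y i (2 * ((fun _ : Fin 3 => 1 - (h : ℤ)) i - 1) - y i)))) =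
        (criticalTwoPoint 3 (Function.update y 0 (2 * (((n : ℤ) + h - 1) + 1) - y 0)) + criticalTwoPoint 3 (Function.update y 0 (2 * ((1 - (h : ℤ)) - 1) - y 0))) +
        (criticalTwoPoint 3 (Function.update y 1 (2 * (((h : ℤ) - 1) + 1) - y 1)) + criticalTwoPoint 3 (Function.update y 1 (2 * ((1 - (h : ℤ)) - 1) - y 1))) +
        (criticalTwoPoint 3 (Function.update y 2 (2 * (((h : ℤ) - 1) + 1) - y 2)) + criticalTwoPoint 3 (Function.update y 2 (2 * ((1 - (h : ℤ)) - 1) - y 2))) := by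
      rw [Fin.sum_univ_three]
      simp
    rw [expand, eGd]
    linarith
  · -- the diagonal box: images of `(n,n,0)`
    set y : Site 3 := Pi.single 0 (n : ℤ) + Pi.single 1 (n : ℤ) with hy
    have t1 : criticalTwoPoint 3 (Function.update y 0 (2 * (((n : ℤ) + h - 1) + 1) - y 0)) ≤ criticalTwoPoint 3 ![2 * (n : ℤ), 0, 0] := by
      have e : Function.update y 0 (2 * (((n : ℤ) + h - 1) + 1) - y 0) = ![2 * (((n : ℤ) + h - 1) + 1) - (n : ℤ), n, 0] := by
        funext j; fin_cases j <;> simp [hy]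
      rw [e, show 2 * (((n : ℤ) + h - 1) + 1) - (n : ℤ) = (n : ℤ) + 2 * h by ring]; exact Df_def
    have t2 : criticalTwoPoint 3 (Function.update y 0 (2 * ((1 - (h : ℤ)) - 1) - y 0)) ≤ criticalTwoPoint 3 ![2 * (n : ℤ), 0, 0] := by
      have e : Function.update y 0 (2 * ((1 - (h : ℤ)) - 1) - y 0) = ![2 * ((1 - (h : ℤ)) - 1) - (n : ℤ), n, 0] := by
        funext j; fin_cases j <;> simp [hy]
      rw [e, show 2 * ((1 - (h : ℤ)) - 1) - (n : ℤ) = -((n : ℤ) + 2 * h) by ring, refl_zero]; exact Df_def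
    have t3 : criticalTwoPoint 3 (Function.update y 1 (2 * (((n : ℤ) + h - 1) + 1) - y 1)) ≤ criticalTwoPoint 3 ![2 * (n : ℤ), 0, 0] := by
      have e : Function.update y 1 (2 * (((n : ℤ) + h - 1) + 1) - y 1) = ![(n : ℤ), 2 * (((n : ℤ) + h - 1) + 1) - (n : ℤ), 0] := by
        funext j; fin_cases j <;> simp [hy]
      rw [e, show 2 * (((n : ℤ) + h - 1) + 1) - (n : ℤ) = (n : ℤ) + 2 * h by ring, ← perm_01]; exact Df_def
    have t4 : criticalTwoPoint 3 (Function.update y 1 (2 * ((1 - (h : ℤ)) - 1) - y 1)) ≤ criticalTwoPoint 3 ![2 * (n : ℤ), 0, 0] := by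
      have e : Function.update y 1 (2 * ((1 - (h : ℤ)) - 1) - y 1) = ![(n : ℤ), 2 * ((1 - (h : ℤ)) - 1) - (n : ℤ), 0] := by
        funext j; fin_cases j <;> simp [hy]
      rw [e, show 2 * ((1 - (h : ℤ)) - 1) - (n : ℤ) = -((n : ℤ) + 2 * h) by ring, refl_one, ← perm_01]; exact Df_def
    have t5 : criticalTwoPoint 3 (Function.update y 2 (2 * (((n : ℤ) - 1) + 1) - y 2)) ≤ criticalTwoPoint 3 ![2 * (n : ℤ), 0, 0] := by
      have e : Function.update y 2 (2 * (((n : ℤ) - 1) + 1) - y 2) = ![(n : ℤ), n, 2 * (((n : ℤ) - 1) + 1) - 0] := by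
        funext j; fin_cases j <;> simp [hy]
      rw [e, show 2 * (((n : ℤ) - 1) + 1) - 0 = 2 * (n : ℤ) by ring]; exact Dt_def
    have t6 : criticalTwoPoint 3 (Function.update y 2 (2 * ((1 - (n : ℤ)) - 1) - y 2)) ≤ criticalTwoPoint 3 ![2 * (n : ℤ), 0, 0] := by
      have e : Function.update y 2 (2 * ((1 - (n : ℤ)) - 1) - y 2) = ![(n : ℤ), n, 2 * ((1 - (n : ℤ)) - 1) - 0] := by
        funext j; fin_cases j <;> simp [hy]
      rw [e, show 2 * ((1 - (n : ℤ)) - 1) - 0 = -(2 * (n : ℤ)) by ring, refl_two]; exact Dt_def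
    have expand : (∑ i : Fin 3, (criticalTwoPoint 3 (Function.update y i
          (2 * ((fun i : Fin 3 => if i = 2 then (n : ℤ) - 1 else (n : ℤ) + (h : ℤ) - 1) i + 1) - y i)) +
        criticalTwoPoint 3 (Function.update y i (2 * ((fun i : Fin 3 => if i = 2 then 1 - (n : ℤ) else 1 - (h : ℤ)) i - 1) - y i)))) =
        (criticalTwoPoint 3 (Function.update y 0 (2 * (((n : ℤ) + h - 1) + 1) - y 0)) + criticalTwoPoint 3 (Function.update y 0 (2 * ((1 - (h : ℤ)) - 1) - y 0))) +
        (criticalTwoPoint 3 (Function.update y 1 (2 * (((n : ℤ) + h - 1) + 1) - y 1)) + criticalTwoPoint 3 (Function.update y 1 (2 * ((1 - (h : ℤ)) - 1) - y 1))) +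
        (criticalTwoPoint 3 (Function.update y 2 (2 * (((n : ℤ) - 1) + 1) - y 2)) + criticalTwoPoint 3 (Function.update y 2 (2 * ((1 - (n : ℤ)) - 1) - y 2))) := by
      rw [Fin.sum_univ_three]
      simp
    rw [expand, eg2]
    linarith

end Summit.CriticalPhenomena.Ising3DConformalLimit.ReflectionTwinExistsContinuousLimit.FreeBox

end
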